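import Mathlib.Geometry.Euclidean.Angle.Unoriented.Basic
import Literature.Geometry.DiscreteGeometry.SphericalCodeHullEuler
import Literature.Geometry.DiscreteGeometry.SphericalCodeContactGraph
import HarnessLib

/-!
# `RobustTangencyBound` — facet corners at a vertex of a soft shell: no vertex is surrounded by
# soft triangles only (helper, Lemma V0 of step (III))

Route `TwoCentreKissingKernel`, item `stmt-AtomisticToContinuum-12082`.  For a finite set `X` of
unit vectors with `0 ∈ interior (conv X)` the facets of `conv X` through a point `y ∈ X` have
corner angles at `y` summing to `2π` (`sum_ballFraction_dirCone_vertex`).  Here: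

* `ballFraction_dirCone_triangle` — for a TRIANGULAR facet `{y, u, w}` the corner fraction at `y`
  is `∠(t_y u, t_y w) / 2π`, the angle between the tangent components at `y` (from
  `argmaxCone_eq_polyCone`, `ballFraction_dirCone_polyCone_vertex`);
* `soft_corner_angle_bounds` — if the three sides are soft (`⟪·,·⟫ ∈ [1/2 − 3η, 1/2 + 2η]`,
  `η ≤ 10⁻³`) that angle lies in `(π/3, 2π/5)` (it is `arccos (1/3) ± 0.5°`);
* `false_of_forall_facet_soft_triangle` — hence NOT every facet through `y` can be a soft
  triangle: `k` corners in `(π/3, 2π/5)` cannot sum to `2π` (`5 < k < 6`).  Every vertex of the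
  hull of a soft twelve-point shell therefore meets an irregular facet (a polygon or a triangle
  with a long side) — the entry point of the cluster case analysis.
-/

noncomputable section

namespace Summit.AtomisticToContinuum.Crystallization.Theorems

open Real RealInnerProductSpace InnerProductGeometry Literature.Geometry.DiscreteGeometry Finset

/-! ### Corner angles of triangular facets -/

/-- For a unit vector `y`, `perpTo y u` is the tangent component `u − ⟪y, u⟫ y`. -/
theorem perpTo_eq_tangentProj {y : EuclideanSpace ℝ (Fin 3)} (hy : ‖y‖ = 1)
    (u : EuclideanSpace ℝ (Fin 3)) : perpTo y u = tangentProj y u := by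
  rw [perpTo_def, tangentProj, real_inner_self_eq_norm_sq, hy, one_pow, div_one]

/-- **The corner fraction of a triangular facet.** If the facet of `c` has exactly the three
vertices `y, u, w`, its tangent-wedge fraction at `y` is `∠(t_y u, t_y w) / 2π`. -/
theorem ballFraction_dirCone_triangle {X : Finset (EuclideanSpace ℝ (Fin 3))}
    (hX1 : ∀ z ∈ X, ‖z‖ = 1)
    (h0 : (0 : EuclideanSpace ℝ (Fin 3)) ∈ interior (convexHull ℝ (X : Set (EuclideanSpace ℝ (Fin 3)))))
    {c : EuclideanSpace ℝ (Fin 3)} (hcF : c ∈ facetNormals X) {y u w : EuclideanSpace ℝ (Fin 3)}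
    (hT : tightSet X c = {y, u, w}) (hyu : y ≠ u) (hyw : y ≠ w) (huw : u ≠ w) :
    ballFraction (0 : EuclideanSpace ℝ (Fin 3)) (dirCone (argmaxCone (facetNormals X) c) y) =
      angle (perpTo y u) (perpTo y w) / (2 * π) := by
  classical
  have hc := ne_zero_of_mem_facetNormals hX1 hcF
  have hcard : (facetAngles X c hc).card = 3 := by
    rw [card_facetAngles hX1 hc, hT, card_insert_of_notMem, card_insert_of_notMem, card_singleton]
    · simpa using huw
    · simp [hyu, hyw]
  have hyT : y ∈ tightSet X c := by rw [hT]; simp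
  obtain ⟨j, hj, hjy⟩ := exists_facetVertex_eq hX1 hc hyT
  have hw : ∀ i j k, i < j → j < k → k < (facetAngles X c hc).card →
      0 < orient3 (facetVertex X c hc i) (facetVertex X c hc j) (facetVertex X c hc k) :=
    fun i j k hij hjk hk => orient3_facetVertex_pos hX1 hcF hij hjk hk
  rw [argmaxCone_eq_polyCone hX1 h0 hcF, ← hjy]
  rw [hcard] at hj hw ⊢
  rw [ballFraction_dirCone_polyCone_vertex le_rfl hw hj, polyDih]
  -- the two other vertices are `u, w` in some order
  have hmem : ∀ i, i < 3 → facetVertex X c hc i ∈ ({y, u, w} : Finset _) := fun i hi => by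
    rw [← hT]; exact facetVertex_mem hc (by rw [hcard]; exact hi)
  have hinj : ∀ i i', i < 3 → i' < 3 → facetVertex X c hc i = facetVertex X c hc i' → i = i' :=
    fun i i' hi hi' h => facetVertex_injOn hc (by rw [Finset.coe_range, Set.mem_Iio, hcard]; exact hi)
      (by rw [Finset.coe_range, Set.mem_Iio, hcard]; exact hi') h
  -- indices
  set i₁ := (j + 1) % 3 with hi₁
  set i₂ := (j + 3 - 1) % 3 with hi₂
  have hi₁3 : i₁ < 3 := Nat.mod_lt _ (by norm_num)
  have hi₂3 : i₂ < 3 := Nat.mod_lt _ (by norm_num)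
  have hne1 : i₁ ≠ j := by rw [hi₁]; omega
  have hne2 : i₂ ≠ j := by rw [hi₂]; omega
  have hne12 : i₁ ≠ i₂ := by rw [hi₁, hi₂]; omega
  have key : ∀ i, i < 3 → i ≠ j → facetVertex X c hc i = u ∨ facetVertex X c hc i = w := by
    intro i hi hij
    have := hmem i hi
    rw [mem_insert, mem_insert, mem_singleton] at this
    rcases this with h | h | h
    · exact absurd (hinj i j hi hj (h.trans hjy.symm)) hij
    · exact Or.inl h
    · exact Or.inr h
  have hdiff : facetVertex X c hc i₁ ≠ facetVertex X c hc i₂ := fun h => hne12 (hinj _ _ hi₁3 hi₂3 h)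
  rcases key i₁ hi₁3 hne1 with h1 | h1 <;> rcases key i₂ hi₂3 hne2 with h2 | h2
  · exact absurd (h1.trans h2.symm) hdiff
  · rw [h1, h2, angle_comm]
  · rw [h1, h2]
  · exact absurd (h1.trans h2.symm) hdiff

/-- `cos (2π/5) < 0.30903` (`cos (2π/5) = (√5 − 1)/4 = 0.30901…`). -/
theorem cos_two_pi_div_five_lt : Real.cos (2 * π / 5) < 30903 / 100000 := by
  have h : Real.cos (2 * π / 5) = 2 * Real.cos (π / 5) ^ 2 - 1 := by
    rw [← Real.cos_two_mul]; ring_nf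
  rw [h, Real.cos_pi_div_five]
  have h5 : Real.sqrt 5 < 22361 / 10000 := by
    rw [Real.sqrt_lt' (by norm_num)]; norm_num
  have h5' : 0 ≤ Real.sqrt 5 := Real.sqrt_nonneg _
  have hsq : Real.sqrt 5 ^ 2 = 5 := Real.sq_sqrt (by norm_num)
  nlinarith [hsq]

/-- The numerical core of `soft_corner_angle_bounds`: with `a, b, s ∈ [1/2 − 3η, 1/2 + 2η]`
(`0 ≤ η ≤ 10⁻³`) and `D ≥ 0`, `D² = (1 − a²)(1 − b²)`, the quotient `(s − ab)/D` lies in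
`(0.30903, 1/2)`. -/
theorem soft_corner_numerics {a b s D η : ℝ} (hη0 : 0 ≤ η) (hη : η ≤ 1 / 1000)
    (ha1 : 1 / 2 - 3 * η ≤ a) (ha2 : a ≤ 1 / 2 + 2 * η) (hb1 : 1 / 2 - 3 * η ≤ b)
    (hb2 : b ≤ 1 / 2 + 2 * η) (hs1 : 1 / 2 - 3 * η ≤ s) (hs2 : s ≤ 1 / 2 + 2 * η) (hD0 : 0 ≤ D)
    (hD2 : D ^ 2 = (1 - a ^ 2) * (1 - b ^ 2)) :
    0 < D ∧ 30903 / 100000 * D < s - a * b ∧ s - a * b < 1 / 2 * D := by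
  have hL0 : (0 : ℝ) ≤ 1 / 2 - 3 * η := by linarith only [hη]
  have ha0 : 0 ≤ a := hL0.trans ha1
  have hb0 : 0 ≤ b := hL0.trans hb1
  -- `ab ∈ [L², U²]`
  have hab1 : (1 / 2 - 3 * η) * (1 / 2 - 3 * η) ≤ a * b := mul_le_mul ha1 hb1 hL0 ha0
  have hab2 : a * b ≤ (1 / 2 + 2 * η) * (1 / 2 + 2 * η) :=
    mul_le_mul ha2 hb2 hb0 (by linarith only [hη0])
  have hN1 : 2449 / 10000 ≤ s - a * b := by nlinarith only [hab2, hs1, hη0, hη]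
  have hN2 : s - a * b ≤ 2551 / 10000 := by nlinarith only [hab1, hs2, hη0, hη]
  -- `a², b² ∈ [L², U²]`
  have haq1 : (1 / 2 - 3 * η) ^ 2 ≤ a ^ 2 := pow_le_pow_left₀ hL0 ha1 2
  have haq2 : a ^ 2 ≤ (1 / 2 + 2 * η) ^ 2 := pow_le_pow_left₀ ha0 ha2 2
  have hbq1 : (1 / 2 - 3 * η) ^ 2 ≤ b ^ 2 := pow_le_pow_left₀ hL0 hb1 2
  have hbq2 : b ^ 2 ≤ (1 / 2 + 2 * η) ^ 2 := pow_le_pow_left₀ hb0 hb2 2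
  have hU2 : (1 / 2 + 2 * η) ^ 2 ≤ 253 / 1000 := by nlinarith only [hη0, hη]
  have hL2 : 247 / 1000 ≤ (1 / 2 - 3 * η) ^ 2 := by nlinarith only [hη0, hη]
  have h1a : 747 / 1000 ≤ 1 - a ^ 2 := by linarith only [haq2, hU2]
  have h1b : 747 / 1000 ≤ 1 - b ^ 2 := by linarith only [hbq2, hU2]
  have h2a : 1 - a ^ 2 ≤ 753 / 1000 := by linarith only [haq1, hL2]
  have h2b : 1 - b ^ 2 ≤ 753 / 1000 := by linarith only [hbq1, hL2]
  have hDl : (747 / 1000 : ℝ) * (747 / 1000) ≤ D ^ 2 := by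
    rw [hD2]; exact mul_le_mul h1a h1b (by norm_num) (by linarith only [h1a])
  have hDu : D ^ 2 ≤ (753 / 1000 : ℝ) * (753 / 1000) := by
    rw [hD2]; exact mul_le_mul h2a h2b (by linarith only [h1b]) (by norm_num)
  have hDl' : 747 / 1000 ≤ D := by
    by_contra h
    push Not at h
    have := mul_lt_mul'' h h hD0 hD0
    rw [pow_two] at hDl
    linarith only [this, hDl]
  have hDu' : D ≤ 753 / 1000 := by
    by_contra h
    push Not at h
    have := mul_lt_mul'' h h (by norm_num) (by norm_num)
    rw [pow_two] at hDu
    linarith only [this, hDu]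
  refine ⟨by linarith only [hDl'], ?_, ?_⟩
  · linarith only [hN1, hDu']
  · linarith only [hN2, hDl']

/-- **Corner angles of soft triangles.** For unit vectors `y, u, w` whose three mutual inner
products lie in `[1/2 − 3η, 1/2 + 2η]` (`0 ≤ η ≤ 10⁻³`), the spherical angle at `y` satisfies
`π/3 < ∠(t_y u, t_y w) < 2π/5`. -/
theorem soft_corner_angle_bounds {y u w : EuclideanSpace ℝ (Fin 3)} (hy : ‖y‖ = 1) (hu : ‖u‖ = 1)
    (hw : ‖w‖ = 1) {η : ℝ} (hη0 : 0 ≤ η) (hη : η ≤ 1 / 1000)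
    (hyu1 : 1 / 2 - 3 * η ≤ ⟪y, u⟫) (hyu2 : ⟪y, u⟫ ≤ 1 / 2 + 2 * η)
    (hyw1 : 1 / 2 - 3 * η ≤ ⟪y, w⟫) (hyw2 : ⟪y, w⟫ ≤ 1 / 2 + 2 * η)
    (huw1 : 1 / 2 - 3 * η ≤ ⟪u, w⟫) (huw2 : ⟪u, w⟫ ≤ 1 / 2 + 2 * η) :
    π / 3 < angle (perpTo y u) (perpTo y w) ∧ angle (perpTo y u) (perpTo y w) < 2 * π / 5 := by
  rw [perpTo_eq_tangentProj hy, perpTo_eq_tangentProj hy]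
  have hN : ⟪tangentProj y u, tangentProj y w⟫ = ⟪u, w⟫ - ⟪y, u⟫ * ⟪y, w⟫ :=
    inner_tangentProj y u w hy
  have hPu : ‖tangentProj y u‖ ^ 2 = 1 - ⟪y, u⟫ ^ 2 := norm_sq_tangentProj hy hu
  have hPw : ‖tangentProj y w‖ ^ 2 = 1 - ⟪y, w⟫ ^ 2 := norm_sq_tangentProj hy hw
  have hD2 : (‖tangentProj y u‖ * ‖tangentProj y w‖) ^ 2 = (1 - ⟪y, u⟫ ^ 2) * (1 - ⟪y, w⟫ ^ 2) := by
    rw [mul_pow, hPu, hPw]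
  obtain ⟨hDpos, hlo, hhi⟩ := soft_corner_numerics hη0 hη hyu1 hyu2 hyw1 hyw2 huw1 huw2
    (mul_nonneg (norm_nonneg _) (norm_nonneg _)) hD2
  have hr_lo : 30903 / 100000 < ⟪tangentProj y u, tangentProj y w⟫ /
      (‖tangentProj y u‖ * ‖tangentProj y w‖) := by
    rw [lt_div_iff₀ hDpos, hN]; exact hlo
  have hr_hi : ⟪tangentProj y u, tangentProj y w⟫ / (‖tangentProj y u‖ * ‖tangentProj y w‖) <
      1 / 2 := by
    rw [div_lt_iff₀ hDpos, hN]; linarith only [hhi]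
  unfold angle
  constructor
  · rw [← Real.arccos_cos (by positivity : (0 : ℝ) ≤ π / 3) (by linarith only [Real.pi_pos]),
      Real.cos_pi_div_three]
    exact Real.arccos_lt_arccos (by linarith only [hr_lo]) hr_hi (by norm_num)
  · rw [← Real.arccos_cos (by positivity : (0 : ℝ) ≤ 2 * π / 5) (by linarith only [Real.pi_pos])]
    refine Real.arccos_lt_arccos (Real.neg_one_le_cos _) ?_ ?_
    · linarith only [cos_two_pi_div_five_lt, hr_lo]
    · linarith only [hr_hi]

/-! ### Lemma V0: not every facet at a vertex is a soft triangle -/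

/-- **No vertex of the hull of a soft shell is surrounded by soft triangles only.** Let `X` be a
finite set of unit vectors with `0 ∈ interior (conv X)` and `y ∈ X`. If every facet through `y`
were a triangle `{y, u, w}` with its three sides soft (mutual inner products in
`[1/2 − 3η, 1/2 + 2η]`, `η ≤ 10⁻³`), the corner fractions at `y` would each lie in `(1/6, 1/5)`
and could not sum to `1`. -/
theorem false_of_forall_facet_soft_triangle {X : Finset (EuclideanSpace ℝ (Fin 3))}
    (hX1 : ∀ z ∈ X, ‖z‖ = 1)
    (h0 : (0 : EuclideanSpace ℝ (Fin 3)) ∈ interior (convexHull ℝ (X : Set (EuclideanSpace ℝ (Fin 3)))))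
    {y : EuclideanSpace ℝ (Fin 3)} (hy : y ∈ X) {η : ℝ} (hη0 : 0 ≤ η) (hη : η ≤ 1 / 1000)
    (hreg : ∀ c ∈ facetNormals X, ⟪c, y⟫ = 1 → ∃ u w : EuclideanSpace ℝ (Fin 3),
      tightSet X c = {y, u, w} ∧ y ≠ u ∧ y ≠ w ∧ u ≠ w ∧ ‖u‖ = 1 ∧ ‖w‖ = 1 ∧
      (1 / 2 - 3 * η ≤ ⟪y, u⟫ ∧ ⟪y, u⟫ ≤ 1 / 2 + 2 * η) ∧
      (1 / 2 - 3 * η ≤ ⟪y, w⟫ ∧ ⟪y, w⟫ ≤ 1 / 2 + 2 * η) ∧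
      (1 / 2 - 3 * η ≤ ⟪u, w⟫ ∧ ⟪u, w⟫ ≤ 1 / 2 + 2 * η)) : False := by
  classical
  have hsum := sum_ballFraction_dirCone_vertex hX1 h0 hy
  set S := (facetNormals X).filter (fun c => ⟪c, y⟫ = 1) with hS
  have hSne : S.Nonempty := by
    obtain ⟨c, hc, hcy⟩ := exists_mem_facetNormals_tight hX1 h0 hy
    exact ⟨c, mem_filter.2 ⟨hc, hcy⟩⟩
  have hbounds : ∀ c ∈ S,
      1 / 6 < ballFraction (0 : EuclideanSpace ℝ (Fin 3)) (dirCone (argmaxCone (facetNormals X) c) y) ∧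
      ballFraction (0 : EuclideanSpace ℝ (Fin 3)) (dirCone (argmaxCone (facetNormals X) c) y) < 1 / 5 := by
    intro c hc
    obtain ⟨hcF, hcy⟩ := mem_filter.1 hc
    obtain ⟨u, w, hT, hyu, hyw, huw, hu, hw, h1, h2, h3⟩ := hreg c hcF hcy
    rw [ballFraction_dirCone_triangle hX1 h0 hcF hT hyu hyw huw]
    have hb := soft_corner_angle_bounds (hX1 y hy) hu hw hη0 hη h1.1 h1.2 h2.1 h2.2 h3.1 h3.2
    have hπ : 0 < 2 * π := by positivity
    constructor
    · rw [lt_div_iff₀ hπ]; linarith [hb.1]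
    · rw [div_lt_iff₀ hπ]; linarith [hb.2]
  have hlt : ∑ c ∈ S, ballFraction (0 : EuclideanSpace ℝ (Fin 3))
      (dirCone (argmaxCone (facetNormals X) c) y) < ∑ _c ∈ S, (1 / 5 : ℝ) :=
    sum_lt_sum_of_nonempty hSne fun c hc => (hbounds c hc).2
  have hgt : ∑ _c ∈ S, (1 / 6 : ℝ) < ∑ c ∈ S, ballFraction (0 : EuclideanSpace ℝ (Fin 3))
      (dirCone (argmaxCone (facetNormals X) c) y) :=
    sum_lt_sum_of_nonempty hSne fun c hc => (hbounds c hc).1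
  rw [hsum] at hlt hgt
  rw [sum_const, nsmul_eq_mul] at hlt hgt
  have h1 : (5 : ℝ) < S.card := by linarith
  have h2 : (S.card : ℝ) < 6 := by linarith
  have h1' : 5 < S.card := by exact_mod_cast h1
  have h2' : S.card < 6 := by exact_mod_cast h2
  omega

end Summit.AtomisticToContinuum.Crystallization.Theorems

end
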